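import Literature.NumberTheory.EllipticCurves.BurungaleCastellaKim2021.HowardTheoremBIrreducible
import HarnessLib

/-!
# Mastella–Zerman 2026, Corollary 4.6 (Howard): one divisibility of Perrin-Riou's Heegner point
# main conjecture for `E/ℚ` WITHOUT surjectivity of the Galois representation — under residual
# IRREDUCIBILITY and "the `p`-adic image contains the scalars `1 + pℤ_p`", `p` ANY odd prime

Topic `NumberTheory/EllipticCurves`. ONE named fact (a `def … : Prop`, D-0014, nothing asserted),
in the exact shape of the tree's `Howard2004_thmB` (`HeegnerModuleIndex.lean`) and of
`BurungaleCastellaKim2021.thm31_howardThmB_of_irreducible` (`HowardTheoremBIrreducible.lean`), plus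
one small definition with a body (the printed image hypothesis) and kernel-checked bookkeeping.

L. Mastella, F. Zerman, *On anticyclotomic Euler and Kolyvagin systems*, Ann. Math. Québec (2026),
doi:10.1007/s40316-026-00269-y = arXiv:2505.08710 [MastellaZerman2026]. Held text: corpus-TeX
`paper:arxiv-2505.08710` (40 chunks `pNNNN` of 3000 characters; theorem numbers = the arXiv
numbering as rendered there). PUBLISHED, refereed.

Cell `bsd-print-x9` (D-0131 (2) PRINT TIER, key `x9`: leaves `ClassX9` — good ordinary `p ∈ {5,7}`,
`E[p]` irreducible, `ρ̄_{E,p}` NOT surjective — and `ClassX10b` — `p = 3`, images 3Ns/3Nn), seat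
`ty1` (typer), 2026-08-27: found in a discovery pass for printed Heegner-point Kolyvagin-system
theorems at irreducible NON-surjective image. HONEST FRAMING: typed ≠ proved ≠ endorsed; the fact
below is an XL input (Kolyvagin systems over the anticyclotomic tower); no class moves, no flag is
discharged by this file.

## The printed statements, verbatim (locators = held chunk : line)

* **§2.1, Assumption 2.1** [p0006:L11–L16]: "Let `(𝓡, 𝔪)` be a complete local Noetherian ring with
  finite residue field of characteristic `p > 2` and let `K` be an imaginary quadratic field of
  discriminant `D_K`. Let `𝐓` be a finite and free `𝓡`-module equipped with a continuous linear
  `G_K`-action. Let `N` be a natural number coprime with `p` such that `𝐓` is unramified outside `Np`.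
  Assumption 2.1. For the rest of the article we assume that • `D_K ∉ {-3,-4}`; • `Np` is coprime
  with `D_K`; • the class number of `K` is not divisible by `p`."
* **§2.5, Assumption 2.13** [p0008:L47–L58]: "The `𝓡⟦G_ℚ⟧`-module `𝐓` has the following properties:
  • it is free of rank `2` as an `𝓡`-module; • the residual `G_ℚ`-representation `𝐓/𝔪_𝓡𝐓` is
  irreducible; • the action of `Fr_ℓ` on `𝐓` has determinant `ℓ` for every prime `ℓ ∤ Np`; • the
  eigenvalues `1` and `-1` of the action of the complex conjugation `τ_c` on `𝐓` both have
  `1`-dimensional eigenspaces; • the image of `G_ℚ` in `Aut_𝓡(𝐓)` contains the scalars `1 + pℤ_p`."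
  Remark 2.14 [L61–L64]: "Point (v) is a big image assumption."
* **§2.8, Lemma 2.39** [p0016:L1–L34] (the image-sensitive Čebotarev lemma, PROVED in the text from
  Assumption 2.13 only: `c^± ∈ H¹(K, 𝐓̄)^±` ⟹ infinitely many admissible `ℓ` with `loc_λ(c^±) ≠ 0`,
  the scalars `σ_α`, `α ∈ 1 + p^sℤ_p`, adjusting the Frobenius class), **Theorem 2.40**
  [p0016:L36–L41] (Howard's structure theorem for a universal Kolyvagin system with `κ(1) ≠ 0`:
  `H¹_𝓛(K,𝐓)` free of rank one, `H¹_𝓛(K,𝐀) ≅ Φ/𝓡 ⊕ M ⊕ M`,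
  `length(M) ≤ length(H¹_𝓛(K,𝐓)/𝓡·κ(1))`; proof [p0017:L1–L4]: "goes along the lines of the proof of
  [Howard], where we replace Lemma 1.6.2 in loc. cit. with Lemma 2.39"), Remark 2.41 [p0017:L6].
* **§3.6, Theorem 3.15** [p0021:L36–L52] (its `Λ^{ac}`-adic counterpart, for `𝓡` a DVR [p0021:L27]).
  Its HYPOTHESIS sentence, verbatim with the citation locators resolved (the held corpus-TeX drops
  the optional arguments of `\cite`; read in the arXiv v2 rendering, §3.6): "Let `𝓛` be a Selmer
  structure on `𝐓^{ac}` satisfying [How04, Hypotheses H.1–H.5] and [LV19, Assumption 3.2]. Suppose that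
  there are `χ_{n,ℓ} ∈ Aut(𝐓^{ac})` such that there is an element
  `κ^{ac} ∈ KS^{uni}(𝐓^{ac}, 𝓛, 𝒫', {χ_{n,ℓ}})` and `𝒫' ⊆ 𝒫` with the property that `κ(1)^{ac} ≠ 0`."
  Conclusions: "• `H¹_𝓛(K,𝐓^{ac})` is a torsion-free `𝓡^{ac}`-module of rank `1`; • there is a finitely
  generated torsion `𝓡^{ac}`-module `M` such that `Char(M) = Char(M)^ι` and a pseudo-isomorphism
  `H¹_𝓛(K,𝐀^{ac})^∨ ∼ 𝓡^{ac} ⊕ M ⊕ M`; • `Char(M)` divides `Char(H¹_𝓛(K,𝐓^{ac})/𝓡^{ac} κ(1)^{ac})`.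
  Proof. The proof proceeds as that of [LV19, Theorem 3.5], by replacing [How04, Proposition 1.6.1]
  (used in the proof of [LV19, Proposition 3.3]) with Theorem 2.40". Here [How04, §1.3 H.1–H.5] are
  Howard's hypotheses on the Selmer triple (`T̄` absolutely irreducible; the splitting field `F` with
  `H¹(F(μ_{p^∞})/K, T̄) = 0`; cartesian local conditions on `Σ(𝓛)`; the self-dual pairing
  `T × T → R(1)` under which `𝓛` is everywhere its own exact orthogonal complement; the residual
  `G_ℚ`/`τ`-conditions), and [LV19, Assumption 3.2] (Longo–Vigni, Kyoto J. Math. 59 (2019), §3.3,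
  imposed "in addition to (H.0)–(H.4)") reads: "(1) the `p`-adic representation `V` is CRYSTALLINE
  and for every prime `v` of `K` above `p` its restriction to `G_{ℚ_p}` is equipped with a filtration
  `0 → Fil⁺_v(T) → T → Fil⁻_v(T) → 0` where `Fil^±_v(T)` are both free of rank `1` over `𝒪` and
  inertia acts trivially on `Fil⁻_v(T)`; (2) … `Fil⁺_v(T)` and `Fil⁺_v(A)` exact annihilators of each
  other under `( , )`; (3) the groups `H⁰(K_{∞,v}, Fil⁻_v(A))` and `H⁰(K_v, Fil⁻_v(A))` are finite for
  all primes `v ∣ p`". So Thm. 3.15 AS PRINTED is an ordinary-CRYSTALLINE statement at `p`: for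
  `(ℤ_p, T_pE)` at a prime `p ∥ N_E` of multiplicative reduction clause (1) fails (`V_pE` is
  semistable, not crystalline) and, at a SPLIT multiplicative `p`, clause (3) fails too
  (`Fil⁻_v(A) = ℚ_p/ℤ_p` with trivial action) — consistent with Cor. 4.6 below being stated only
  after "Suppose now that `E` has good ordinary reduction at `p`" (cell `bsd-stepL` sheet
  `audit/T-g9-2-MZ26-Thm315-defn-ty1-g13.md`, 2026-08-28).
* **§4 standing** [p0022:L3]: "Throughout, `p` will be an odd prime, `K` will be an imaginary
  quadratic field and `N` a positive integer not divisible by `p` satisfying the Heegner hypothesis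
  in `K`, i.e., such that the primes dividing `N` split in `K`." **§4.1** [p0022:L13]: "Let `E` be an
  elliptic curve defined over `ℚ` without complex multiplication, of conductor `N`. Its Tate module
  `T_pE` … the couple `(𝓡, 𝐓) = (ℤ_p, T_pE)` satisfies Assumptions 2.12 and 2.13 if we suppose that
  `E[p]` is irreducible and that the image of the representation contains the scalars `1 + pℤ_p`. This
  is true if for instance the representation is surjective".
* **Corollary 4.3 (Kolyvagin)** [p0023:L7–L13]: "If `P_K = Tr_{K[1]/K}(P_1) ≠ 0`, then `S_p(E/K)` is
  free of rank `1` over `ℤ_p` and there is a finite `ℤ_p`-module `M` such that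
  `Sel_{p^∞}(E/K) ≅ (ℚ_p/ℤ_p) ⊕ M ⊕ M`. Furthermore, we have that
  `length_{ℤ_p}(M) ≤ length_{ℤ_p}(S_p(E/K)/ℤ_p 𝐜_{hp,K})`." — NOT typed here (its bound clause is
  implied by the tree's `MatarNekovar2019.thm03_padicValNat_card_sha_le_of_irreducible`, printed
  under WEAKER hypotheses; its `M ⊕ M` clause has no consumer).
* **Theorem 4.5 / Corollary 4.6 (Howard)** [p0023:L31–L62], after "Suppose now that `E` has good
  ordinary reduction at `p`" [L27] and Howard's points `Q_{α,n}`, `𝐛(np^α)_{hp} = δ(Q_{α,n})`,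
  `𝐛^{ac}_{K,hp} ∈ H¹_{𝓛_Gr}(K, 𝐓^{ac})` [L44–L50]: "**Corollary 4.6 (Howard).**
  `H¹_{𝓛_Gr}(K, 𝐓^{ac})` is a torsion-free `Λ^{ac}`-module of rank `1`. Moreover, there is a finitely
  generated torsion `Λ^{ac}`-module `M` such that • `Char(M) = Char(M)^ι`; •
  `H¹_{𝓛_Λ}(K, 𝐀^{ac})^∨ ∼ Λ^{ac} ⊕ M ⊕ M`; • `Char(M) ⊇ Char(H¹_{𝓛_Gr}(K, 𝐓^{ac})/Λ^{ac}𝐛^{ac}_{hp,K})`.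
  Proof. This is Theorem 3.15 for `κ^{ac} = κ^{ac}_{hp}`, as `κ^{ac}_{hp}(1) ≠ 0` by the main result
  of [Cornut]." Here [L51–L53] `H¹_{𝓛_Gr}(K,𝐓^{ac}) ∼ lim←_n S_p(E/K_n)` and
  `H¹_{𝓛_Gr}(K,𝐀^{ac}) ∼ lim→_n Sel_{p^∞}(E/K_n)` — Howard's `H¹_{F_Λ}(K,𝐓)`, `X`, and
  `Λ^{ac}𝐛^{ac} = 𝐇 = Λκ₁^{Heeg}` (Howard 2004, Thm. 3.3.7) — the objects of `Howard2004_thmB`.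

## What changes relative to the tree's two records of the same theorem

* `Howard2004_thmB` (Howard, Compositio 140 (2004), Thm. B): printed under
  "`Gal(K̄/K) → Aut_{ℤ_p}(T_pE)` surjective" (`HowardHypotheses.surjective`).
* `BurungaleCastellaKim2021.thm31_howardThmB_of_irreducible` (BCK21 Thm. 3.1): `p > 3`,
  `ρ̄|_{G_K}` absolutely irreducible — PROOF BY CITATION (flag `BCK21-3.1@How04+Fouquet13`).
* THIS file (MZ26 Cor. 4.6): `p` ANY odd prime (so `p = 3` is in scope as printed), `E` non-CM,
  `E[p]` irreducible over `G_ℚ`, AND the `p`-adic image of `G_ℚ` contains the scalars `1 + pℤ_p`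
  (`HasPadicScalarImage`, a per-curve certificate: it holds whenever the `p`-adic image is the full
  preimage of the mod-`p` image, since then it contains `1 + pM₂(ℤ_p) ∋ (1+p)·I`), with the
  image-sensitive step re-proved in the text (Lemma 2.39). On the locus `p ≥ 5` the typed fact is
  IMPLIED by BCK21's (`conclusion_of_thm31`, below); its statement-level novelty is `p = 3`.
  provenance: Cor. 4.6 ⟸ Thm. 3.15 ⟸ Thm. 2.40, whose proofs are printed "along the lines of"
  Howard 2004 / Longo–Vigni 2019 with Lemma 1.6.2 replaced by the in-body Lemma 2.39; Howard's
  H.2–H.5 "hold as explained in loc. cit., proof of Theorem 1.6.5" [p0023:L13]. scope note for the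
  referee: Howard's own Theorems A/B are printed for "`p` odd and the integers `p`, `D`, and `N`
  pairwise coprime" (arXiv:1202.6340, Thm. 1; the tree's `HowardHypotheses.p_ne_two`), so the
  printed "`p` odd" of MZ26 §4 inherits no hidden `p > 3` from Howard (BCK21's `p > 3` belongs to
  its own route via Fouquet 2013); the binder below is `p ≠ 2` exactly as printed.

Why the cell records it (consumers): (i) Burungale–Castella–Skinner 2025 prove the INTEGRAL
Heegner-point / BDP main conjectures (their Thms. 1.2.2 (b), 1.2.4 (b), tree
`BurungaleCastellaSkinner2025.thm122b_…`) from the rational ones plus "[How04, Thm. B]" — the ONLY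
place (sur) enters their Thm. 4.2.1 (arXiv:2405.00270v2 p. 8: "Under (sur), part (a) follows from
[How04, Thm. B]"); a print of Howard's divisibility at non-surjective image is the missing piece of
that composite on the leaves `ClassX9` / `ClassX10b`; (ii) route `PrintX9`, crux `MultiPrimeX9`
(planner §7(a): "integral anticyclotomic MC open at non-surjective image"); (iii) cell `bsd-smallim`
seat `koly` (`Summits/…/Rank1ResidualX9SmallImageKolyvagin.lean`, `Howard2004_thmB_of_irreducible`):
an independent refereed print of the same repair under an explicit image certificate.

presearch (D-0021, 2026-08-27): `lean search`/`rg` "Mastella|Zerman|2505.08710" → nothing in the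
tree; Howard-at-non-surjective-image by name → the two records above (both kept, cited, not
restated: this fact has different hypotheses); [corpus: paper:arxiv-2505.08710 p0008, p0016,
p0021–p0023] the statements transcribed; [corpus: paper:arxiv-2405.00270 p0008:L111–113] the BCS
use of Howard; galaxy all "bipartite Euler systems and higher congruences|Kolyvagin's conjecture,
bipartite" → 0 rows; related prints checked and NOT usable at (irr ∧ ¬sur): Zanarella
arXiv:1908.09197 (res-surj) [p0004:L10–13], Da Ronche–Longo–Vigni arXiv:2603.12357 ((sur), `p ≥ 5`)
[p0003:L7–9], C.-H. Kim arXiv:2203.12161 ((sur)).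

## References

* [MastellaZerman2026] L. Mastella, F. Zerman, Ann. Math. Québec (2026) = arXiv:2505.08710:
  Assumptions 2.1, 2.12, 2.13, Lemma 2.39, Thm. 2.40, Rem. 2.41, Thm. 3.15, Thm. 4.2, Cor. 4.3,
  Thm. 4.5, Cor. 4.6 — read (held corpus-TeX).
* [Howard2004HeegnerKolyvagin] B. Howard, Compositio Math. 140 (2004) 1439–1472, Thms. A, B,
  §1.3 Hypotheses H.0–H.5 (= arXiv:1202.6340 §2.3, read), Prop./Thm. 1.6.1, Lemma 1.6.2, Thm. 1.6.5,
  Thm. 3.3.7.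
* [LongoVigni2019] M. Longo, S. Vigni, Kyoto J. Math. 59 (2019) 717–746 = arXiv:1605.03168, §3.1
  (H.0)–(H.5), §3.3 Assumption 3.2, §3.4 Props. 3.3–3.4, Thm. 3.5 — read (held corpus-TeX); the
  hypothesis block imported by MZ26 Thm. 3.15.
* [BurungaleCastellaKim2021] ANT 15 (2021), Thm. 3.1 (the tree's other (irr)-record).
* [BurungaleCastellaSkinner2025] IMRN 2025 = arXiv:2405.00270v2, Thm. 4.2.1 and its proof (p. 8),
  Rem. 1.2.3 ("Under (irr_ℚ), the only case excluded by Theorem 1.2.2(b) is that of (residually)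
  dihedral primes `p`. It will be treated in [BS24]").
* [PerrinRiou1987BSMF] B. Perrin-Riou, Bull. SMF 115 (1987) — the conjecture.
-/

noncomputable section

open scoped Classical

universe u

namespace Literature.NumberTheory.EllipticCurves.MastellaZerman2026

open WeierstrassCurve Literature.NumberTheory.EllipticCurves

/-! ### 1. The printed image hypothesis (Assumption 2.13 (v)), with a body -/

/-- **Mastella–Zerman 2026, Assumption 2.13, last point, for `(𝓡, 𝐓) = (ℤ_p, T_pE)`**: "the image of
`G_ℚ` in `Aut_𝓡(𝐓)` contains the scalars `1 + pℤ_p`" — every scalar endomorphism `a · id` of the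
tree's Tate module `T_pE` (`tateModule`) with `a ≡ 1 (mod p)` is `ρ_{E,p^∞}(σ)` (`galoisRepTate`) for
some `σ ∈ Γ_ℚ`. A PREDICATE on `(E, p)`; per curve it is a finite certificate once the level of the
`p`-adic image is known (level `p` suffices). [cite: MastellaZerman2026, Assumption 2.13 (v) and §4.1 (arXiv:2505.08710)] -/
def HasPadicScalarImage (W : WeierstrassCurve ℚ) (p : ℕ) [Fact p.Prime] : Prop :=
  ∀ a : ℤ_[p], (p : ℤ_[p]) ∣ a - 1 →
    a • (1 : Module.End ℤ_[p] (W.tateModule p)) ∈ Set.range (galoisRepTate W p)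

/-- Unfolding `HasPadicScalarImage`. [cite: MastellaZerman2026, Assumption 2.13 (v)] -/
theorem hasPadicScalarImage_iff (W : WeierstrassCurve ℚ) (p : ℕ) [Fact p.Prime] :
    HasPadicScalarImage W p ↔ ∀ a : ℤ_[p], (p : ℤ_[p]) ∣ a - 1 →
      ∃ σ : Field.absoluteGaloisGroup ℚ,
        galoisRepTate W p σ = a • (1 : Module.End ℤ_[p] (W.tateModule p)) :=
  Iff.rfl

/-- A `p`-adic integer congruent to `1 mod p` is a unit (`ℤ_p` is local with maximal ideal `(p)`);
private helper. [folklore] -/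
private theorem isUnit_of_dvd_sub_one {p : ℕ} [Fact p.Prime] {a : ℤ_[p]} (ha : (p : ℤ_[p]) ∣ a - 1) :
    IsUnit a := by
  have hmem : 1 - a ∈ nonunits ℤ_[p] := by
    rw [← IsLocalRing.mem_maximalIdeal, PadicInt.maximalIdeal_eq_span_p, Ideal.mem_span_singleton]
    have : (1 : ℤ_[p]) - a = -(a - 1) := by ring
    rw [this]
    exact (dvd_neg).mpr ha
  have h := IsLocalRing.isUnit_one_sub_self_of_mem_nonunits (1 - a) hmem
  rwa [sub_sub_cancel] at h

/-- **MZ26 §4.1: "This is true if for instance the representation is surjective."** If every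
`ℤ_p`-linear automorphism of `T_pE` is a Galois element (surjectivity of `Γ_ℚ → Aut_{ℤ_p}(T_pE)`, the
`ℚ`-analogue of `HowardHypotheses.surjective`), then the image contains the scalars `1 + pℤ_p`.
[cite: MastellaZerman2026, §4.1 (arXiv:2505.08710)] -/
theorem HasPadicScalarImage.of_surjective (W : WeierstrassCurve ℚ) (p : ℕ) [Fact p.Prime]
    (hsurj : ∀ f : Module.End ℤ_[p] (W.tateModule p), IsUnit f →
      f ∈ Set.range (galoisRepTate W p)) :
    HasPadicScalarImage W p := by
  intro a ha
  refine hsurj _ ?_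
  rw [← Algebra.algebraMap_eq_smul_one]
  exact (isUnit_of_dvd_sub_one ha).map _

/-! ### 2. The standing hypotheses of Cor. 4.6, as a `Prop`-structure (shape of `HowardHypotheses`) -/

section Facts

variable (N : ℕ) [NeZero N] (W : WeierstrassCurve ℚ) [W.IsGloballyMinimal] (K : Type u) [Field K]
  [NumberField K] (p : ℕ) [Fact p.Prime] (κ : ZpExtension K p) (γ : Field.absoluteGaloisGroup K)
  (jbar : AlgebraicClosure K →+* ℂ)

/-- **The hypotheses of Mastella–Zerman 2026, Cor. 4.6, for `(ℤ_p, T_pE)`** = the tree's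
`HowardHypotheses N W K p κ γ` with the field `surjective` ("`Γ_K → Aut_{ℤ_p}(T_pE)` onto") REPLACED
by the three printed conditions of §4.1 / Assumption 2.13: `E` has no complex multiplication, `E[p]`
is an irreducible `𝔽_p[G_ℚ]`-module, and the `p`-adic image of `G_ℚ` contains the scalars `1 + pℤ_p`;
everything else verbatim: `E/ℚ` elliptic; `K` imaginary quadratic, `D_K ∉ {-3,-4}` (Assumption 2.1);
every prime of `N` splits in `K` (§4 standing Heegner hypothesis; the level `N` is tied to `E` by the
`HeegnerFamily` datum exactly as in `Howard2004_thmB`); `p` odd (§4: "`p` will be an odd prime");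
`p ∤ N` (§2.1: "`N` … coprime with `p`", i.e. good reduction at `p`); `p ∤ D_K` (Assumption 2.1:
"`Np` is coprime with `D_K`"); `p ∤ h_K` (Assumption 2.1); `E` good ORDINARY at `p` (§4.1 before
Thm. 4.5: "Suppose now that `E` has good ordinary reduction at `p`"); `κ` the anticyclotomic
`ℤ_p`-extension with topological generator `γ`. (The remaining points of Assumption 2.13 —
`det ρ(Fr_ℓ) = ℓ`, complex conjugation with two one-dimensional eigenspaces — hold for every `T_pE`
by the Weil pairing and are not binders, as in §4.1: "satisfies Assumptions 2.12 and 2.13 if we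
suppose that `E[p]` is irreducible and that the image … contains the scalars `1 + pℤ_p`".)
[cite: MastellaZerman2026, Assumption 2.1, Assumption 2.13, §4 and §4.1 (arXiv:2505.08710)] -/
structure Hypotheses : Prop where
  /-- `E` is an elliptic curve. -/
  isElliptic : W.IsElliptic
  /-- `E` has no complex multiplication (§4.1). -/
  notCM : ¬ W.HasCM
  /-- `E[p]` is an irreducible `𝔽_p[G_ℚ]`-module (Assumption 2.13 (ii)). -/
  irreducible : W.HasIrreducibleModPGaloisRep p
  /-- The `p`-adic image of `G_ℚ` contains the scalars `1 + pℤ_p` (Assumption 2.13 (v)). -/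
  scalars : HasPadicScalarImage W p
  /-- `K` is imaginary quadratic. -/
  isImaginaryQuadratic : IsImaginaryQuadratic K
  /-- `d_K ≠ -3, -4` (Assumption 2.1). -/
  discr_ne : NumberField.discr K ≠ -3 ∧ NumberField.discr K ≠ -4
  /-- Every prime dividing `N` splits in `K` (§4 Heegner hypothesis). -/
  heegner : SatisfiesHeegnerHypothesis N K
  /-- `p` is odd (§4). -/
  p_ne_two : p ≠ 2
  /-- `p ∤ N` (§2.1). -/
  not_dvd_level : ¬ p ∣ N
  /-- `p ∤ d_K` (Assumption 2.1). -/
  not_dvd_discr : ¬ (p : ℤ) ∣ NumberField.discr K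
  /-- `p ∤ h_K` (Assumption 2.1). -/
  not_dvd_classNumber : ¬ p ∣ NumberField.classNumber K
  /-- `E` has good ordinary reduction at `p` (§4.1). -/
  ordinary : IsOrdinaryAt W p
  /-- `κ` is the anticyclotomic `ℤ_p`-extension of `K`. -/
  anticyclotomic : κ.IsAnticyclotomic
  /-- `γ` is a topological generator of `Gal(K_∞/K)`. -/
  topGenerator : κ.IsTopGenerator γ

/-! ### 3. Corollary 4.6 as a named fact (shape of `Howard2004_thmB`) -/

/-- **Mastella–Zerman 2026, Corollary 4.6 (Howard) — Howard's Theorem B WITHOUT surjectivity, at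
ANY odd `p`, under residual irreducibility and "the `p`-adic image contains `1 + pℤ_p`"** (named
fact, D-0014; nothing asserted). Printed: "`H¹_{𝓛_Gr}(K, 𝐓^{ac})` is a torsion-free `Λ^{ac}`-module of
rank `1`. Moreover, there is a finitely generated torsion `Λ^{ac}`-module `M` such that
`Char(M) = Char(M)^ι`; `H¹_{𝓛_Λ}(K, 𝐀^{ac})^∨ ∼ Λ^{ac} ⊕ M ⊕ M`; `Char(M) ⊇ Char(H¹_{𝓛_Gr}(K,
𝐓^{ac})/Λ^{ac}𝐛^{ac}_{hp,K})`. Proof. This is Theorem 3.15 for `κ^{ac} = κ^{ac}_{hp}`, as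
`κ^{ac}_{hp}(1) ≠ 0` by the main result of [Cornut]." Recorded under `Hypotheses N W K p κ γ`, for
every `Λ`-adic Selmer datum `D` (`D.S ∼ lim← S_p(E/K_n) ∼ H¹_{𝓛_Gr}(K,𝐓^{ac})`), Heegner family `F`
(`Λ^{ac}𝐛^{ac}_{hp,K}` = Howard's `𝐇`, the tree's `heegnerModule D F`) and Selmer-dual datum `X`
(`X.X ∼ H¹(K,𝐀^{ac})^∨`), through the SAME pseudo-isomorphism-invariant consequences as
`Howard2004_thmB` (weaker than print, never stronger; `Char(M) = Char(M)^ι` not recorded): `D.S`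
finitely generated, torsion-free, of rank one; `X.X` finitely generated of rank one; and
`char_Λ(X_{Λ-tors}) = Char(M)²` divides `I(ℋ_∞)² = heegnerCharIdeal D F ^ 2`.
[cite: MastellaZerman2026, Cor. 4.6 with Thm. 3.15, Thm. 2.40, Lemma 2.39, Assumptions 2.1/2.13 (arXiv:2505.08710 numbering)]
[cite: Howard2004HeegnerKolyvagin, §1 Thm. B and Thm. 3.3.7] -/
def cor46_howardDivisibility_of_scalarImage : Prop :=
  ∀ (N : ℕ) [NeZero N] (W : WeierstrassCurve ℚ) [W.IsGloballyMinimal]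
    (K : Type u) [Field K] [NumberField K] (p : ℕ) [Fact p.Prime] (κ : ZpExtension K p)
    (γ : Field.absoluteGaloisGroup K) (jbar : AlgebraicClosure K →+* ℂ),
    Hypotheses N W K p κ γ →
    ∀ (D : (W.baseChange K).LambdaAdicSelmerData κ γ) (F : HeegnerFamily N W K κ jbar)
      (X : (W.baseChange K).SelmerDualData κ γ),
      (Module.Finite (IwasawaAlgebra p) D.S ∧ NoZeroSMulDivisors (IwasawaAlgebra p) D.S ∧
          Module.finrank (IwasawaAlgebra p) D.S = 1) ∧
        (Module.Finite (IwasawaAlgebra p) X.X ∧ Module.finrank (IwasawaAlgebra p) X.X = 1 ∧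
          Module.charIdeal (IwasawaAlgebra p) (Submodule.torsion (IwasawaAlgebra p) X.X) ∣
            heegnerCharIdeal D F ^ 2)

/-! ### 4. Kernel bookkeeping: relation to the tree's other records of Howard's theorem -/

variable {N W K p κ γ}

/-- **On the locus `p ≥ 5` the new fact is IMPLIED by the tree's BCK21 record**: the conclusion of
Cor. 4.6 follows from `BurungaleCastellaKim2021.thm31_howardThmB_of_irreducible` for every datum
satisfying `Hypotheses` with `5 ≤ p` (that record needs neither "non-CM" nor the scalar certificate).
So the statement-level novelty of Cor. 4.6 in the tree is exactly the case `p = 3`; its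
provenance novelty (in-body image lemma 2.39) is docstring-level. [cite: BurungaleCastellaKim2021, Thm. 3.1]
[cite: MastellaZerman2026, Cor. 4.6] -/
theorem conclusion_of_thm31 (h31 : BurungaleCastellaKim2021.thm31_howardThmB_of_irreducible.{u})
    (hyp : Hypotheses N W K p κ γ) (hp : 5 ≤ p)
    (D : (W.baseChange K).LambdaAdicSelmerData κ γ) (F : HeegnerFamily N W K κ jbar)
    (X : (W.baseChange K).SelmerDualData κ γ) :
    (Module.Finite (IwasawaAlgebra p) D.S ∧ NoZeroSMulDivisors (IwasawaAlgebra p) D.S ∧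
        Module.finrank (IwasawaAlgebra p) D.S = 1) ∧
      (Module.Finite (IwasawaAlgebra p) X.X ∧ Module.finrank (IwasawaAlgebra p) X.X = 1 ∧
        Module.charIdeal (IwasawaAlgebra p) (Submodule.torsion (IwasawaAlgebra p) X.X) ∣
          heegnerCharIdeal D F ^ 2) := by
  haveI : W.IsElliptic := hyp.isElliptic
  exact h31 N W K p κ γ jbar hyp.isImaginaryQuadratic hyp.discr_ne hyp.heegner hp
    hyp.not_dvd_level hyp.not_dvd_discr hyp.not_dvd_classNumber hyp.irreducible hyp.ordinary
    hyp.anticyclotomic hyp.topGenerator D F X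

/-- **Consumer edge**: the named fact delivers Howard's conclusion at every datum satisfying the
printed hypotheses — in particular at `p = 3` (where `thm31_howardThmB_of_irreducible` and
`Howard2004_thmB`'s big-image hypothesis are both unavailable on the leaf `ClassX10b`).
[cite: MastellaZerman2026, Cor. 4.6] -/
theorem conclusion_of_cor46 (h : cor46_howardDivisibility_of_scalarImage.{u})
    (hyp : Hypotheses N W K p κ γ)
    (D : (W.baseChange K).LambdaAdicSelmerData κ γ) (F : HeegnerFamily N W K κ jbar)
    (X : (W.baseChange K).SelmerDualData κ γ) :
    Module.charIdeal (IwasawaAlgebra p) (Submodule.torsion (IwasawaAlgebra p) X.X) ∣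
      heegnerCharIdeal D F ^ 2 :=
  (h N W K p κ γ jbar hyp D F X).2.2.2

end Facts

end Literature.NumberTheory.EllipticCurves.MastellaZerman2026

end
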